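import Summits.BirchSwinnertonDyer.BirchSwinnertonDyer.Theorems.ByReductionTypeAtTwoTowerClassKitE
import Literature.NumberTheory.EllipticCurves.CyclotomicZpExtensionLayerTwoProofs
import Literature.NumberTheory.LocalFields.PadicRootsOfUnity
import Literature.NumberTheory.EllipticCurves.Sha
import HarnessLib

/-!
# The LAYER-`j` TORSION CERTIFICATE of the torsion-tolerant TOWER gap: for a good prime
# `ℓ ≡ 1 (mod 2^{j+2})`, `#E[2^∞]^{Gal(ℚ̄/ℚ_j)} ≤ 2^{ord₂ #Ẽ(𝔽_ℓ)}` — via the decomposition group at `ℓ`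
# (route ByReductionTypeAtTwo, items 19573 / 19271 on the INELIG classes that close only at a layer pair
# `(j, j')` with LOWER layer `j ≥ 1`; seat bsd-2adic-ord-2 GEN 6)

HONEST FRAMING (cell `bsd-2adic`, run/shared/lean/pub/bsd-2adic/, HUMAN RULINGS D-0036 / D-0054 / D-0074):
THEOREMS ONLY; nothing asserted; no definition; no new named fact; closes nothing by itself.

The torsion-tolerant gap door `TowerClass.towerGapAtTwo_of_counts_of_torsion` (`…TowerLayerTorsion.lean`,
GEN 4) needs, at the LOWER layer `j`, a bound `#E[2^∞]^{Gal(ℚ̄/ℚ_j)} ≤ 2^t` on the `2`-power torsion of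
`E(ℚ̄)` fixed by `Gal(ℚ̄/ℚ_j)` (`ℚ_j` the `j`-th layer of the cyclotomic `ℤ₂`-extension; this is
`#ker h_j`). KitD (`natCard_fixedPoints_geomPrimaryTorsion_le_pow_of_good`) certifies it at `j = 0` only
(Galois descent to `E(ℚ)` and `ord_p #E(ℚ)_tors ≤ ord_p #Ẽ(𝔽_ℓ)`), so every INELIG class file so far
displays a pair `(0, j')`. MEMO-3 §3 (d) of the seat lists the classes that close only at `(1,3)` /
`(2,3)` and names the missing lemma; this file proves it, in the tree's own currency and with no new input:

* §1 `resGal_mem_rootsOfUnityFixer_of_isPrimitiveRoot` — for a `K`-field `E` containing a primitive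
  `n`-th root of unity, the restriction `res : Γ_E → Γ_K` (tree `resGal`, along the chosen `K̄ ↪ Ē`)
  lands in `Gal(K̄/K(μ_n))` (tree `rootsOfUnityFixer`): the `n`-th roots of unity of `Ē` are powers of
  the one in `E`. With `μ_{ℓ−1} ⊂ ℚ_ℓ` (tree `LocalFields.padic_exists_isPrimitiveRoot_of_dvd`, Hensel)
  and `Gal(ℚ̄/ℚ(μ_{2^{j+2}})) ≤ Gal(ℚ̄/ℚ_j)` (tree `IsCyclotomic.rootsOfUnityFixer_le_layerSubgroup_two`,
  p460574): **`res(Γ_{ℚ_ℓ}) ≤ Gal(ℚ̄/ℚ_j)` whenever `2^{j+2} ∣ ℓ − 1`** (`resGal_padic_mem_layerSubgroup_two`).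
* §2 Galois descent over a PERFECT field `F` with FINITE rational torsion (a local field):
  `E[p^∞]^{Γ_F} ↪ E(F)[p^v]`, `v = ord_p #E(F)_tors`, hence `#E[p^∞]^{Γ_F} ≤ p^v` and finiteness
  (`finite_and_natCard_fixedPoints_geomPrimaryTorsion_le_pow`; KitD §1 is the number-field case).
* §3 `natCard_fixedBy_le_natCard_fixedPoints_baseChange` — if `res(Γ_E) ≤ H ≤ Γ_K`, the `H`-fixed
  `p`-power torsion of `E(K̄)` injects (tree `pointsMap`, injective and `resGal`-equivariant) into the
  `Γ_E`-fixed `p`-power torsion of the local curve `W.baseChange E` (whose geometric points are the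
  tree's `localPoints W E`, the same type).
* §4 `K = ℚ`, `p = 2`, `E = ℚ_ℓ`: `#E(ℚ_ℓ)_tors ∣ #Ẽ(𝔽_ℓ)` at good `ℓ ≥ 3` (tree
  `LocalLog.card_torsion_baseChange_dvd` + `c_ℓ = 1`), whence
  **`natCard_fixedBy_layerSubgroup_le_pow_of_goodPrime(_card)`**: `2^{j+2} ∣ ℓ − 1`, `#Ẽ(𝔽_ℓ) = n`,
  `¬ 2^{t+1} ∣ n` ⇒ `#E[2^∞]^{Gal(ℚ̄/ℚ_j)} ≤ 2^t` for every cyclotomic `κ`.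
* §5 the doors in certificate currency at a pair `(j, j')`, `j ≤ j'`:
  `TowerClass.towerGapAtTwo_of_counts_of_goodPrime_card_layer` (STRICT Selmer lower count at layer `j`,
  TowerLayerTorsion's door) and `TowerClass.towerGapAtTwo_of_classCounts_of_goodPrime_card_layer`
  (`A`-currency lower count, KitE's door); PRINT `hB` (finiteness of `E(ℚ_∞)[2^∞]`, Greenberg LNM 1716 §1)
  as in every INELIG file. The doors AT `W` (item 19573 / 19271, `MissingUpperBoundAt`, `BSD₂`) are KitD §3 /
  ord-3's, unchanged.

What `t` to expect: such `ℓ` split completely in `ℚ(ζ_{2^{j+2}}) ⊇ ℚ_j`, so `E(ℚ_j)[2^∞] ↪ E(ℚ_ℓ)[2^∞] ↪ Ẽ(𝔽_ℓ)`;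
the certified `t` may exceed the engines' `t_j = ord₂ #E(ℚ_j)[2^∞]` when `E` gains `2`-power torsion over
`ℚ(ζ_{2^{j+2}})` — it is an upper bound, found per class by a search over `ℓ`.

References: [GreenbergLNM1716] §1, §3 pp. 85–86, §4 Lemma 4.3; [SilvermanAEC2009] VII.3.1(b), VIII.§1, X.§4;
[Washington1997] §13.1; [Gouvea1993PadicNumbers] §4.6 Prop. 4.6.1; [SerreGaloisCohomology1997] II.§1.1.
-/

set_option autoImplicit false
-- the route's Theorems namespace repeats a component by design (summit = sub-problem, D-0017).
set_option linter.dupNamespace false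

noncomputable section

open scoped Classical

open WeierstrassCurve Literature.NumberTheory.EllipticCurves Literature.NumberTheory.GaloisRepresentations
  Field

universe u

namespace Summit.BirchSwinnertonDyer.BirchSwinnertonDyer.Theorems.TowerLayer

/-! ## §1 The decomposition group at a place with enough roots of unity fixes `μ_n` -/

section Fixer

variable {K : Type u} [Field K] (E : Type u) [Field E] [Algebra K E]

/-- **`res(Γ_E) ≤ Gal(K̄/K(μ_n))` when `μ_n ⊂ E`.** If the `K`-field `E` contains a primitive `n`-th root
of unity (`n ≠ 0`), then every `τ ∈ Γ_E = Gal(Ē/E)` restricts (along the chosen embedding `K̄ ↪ Ē`,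
tree `resGal`) to an element of `Γ_K` fixing every `n`-th root of unity of `K̄`: the `n`-th roots of
unity of `Ē` are the powers of the one in `E`, which `τ` fixes. [folklore]
[cite: NeukirchANT1999, Ch. II §7 (unramified extensions; `μ_{q-1} ⊂ K_v`)] -/
theorem resGal_mem_rootsOfUnityFixer_of_isPrimitiveRoot {n : ℕ} [NeZero n] {ζ : E}
    (hζ : IsPrimitiveRoot ζ n) (τ : absoluteGaloisGroup E) :
    resGal (K := K) E τ ∈ rootsOfUnityFixer K n := by
  rw [mem_rootsOfUnityFixer_iff]
  intro t ht
  -- the chosen embedding `ι : K̄ → Ē` and the defining relation `ι ∘ res τ = τ ∘ ι`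
  set ι : AlgebraicClosure K →ₐ[K] AlgebraicClosure E := closureEmb (K := K) E with hι
  have hrel : ι ((show AlgebraicClosure K ≃ₐ[K] AlgebraicClosure K from resGal (K := K) E τ) t) =
      (show AlgebraicClosure E ≃ₐ[E] AlgebraicClosure E from τ) (ι t) :=
    apply_resGalAuxOfEmb_apply ι τ t
  -- `ι t` is an `n`-th root of unity of `Ē`, hence a power of `ζ' = ζ ∈ E ⊂ Ē`
  have hζ' : IsPrimitiveRoot (algebraMap E (AlgebraicClosure E) ζ) n :=
    hζ.map_of_injective (algebraMap E (AlgebraicClosure E)).injective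
  have hιt : (ι t) ^ n = 1 := by rw [← map_pow, ht, map_one]
  obtain ⟨i, -, hi⟩ := hζ'.eq_pow_of_pow_eq_one hιt
  -- `τ` fixes `ι t`
  have hfix : (show AlgebraicClosure E ≃ₐ[E] AlgebraicClosure E from τ) (ι t) = ι t := by
    rw [← hi, map_pow, AlgEquiv.commutes]
  rw [hfix] at hrel
  -- conclude by injectivity of `ι`
  have hinj : Function.Injective ι := ι.toRingHom.injective
  rw [absoluteGaloisGroup.smul_def]
  exact hinj hrel

/-- **`res(Γ_{ℚ_ℓ}) ≤ Gal(ℚ̄/ℚ(μ_m))` for `m ∣ ℓ − 1`** (`μ_{ℓ-1} ⊂ ℚ_ℓ` by Hensel, tree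
`LocalFields.padic_exists_isPrimitiveRoot_of_dvd`). [cite: Gouvea1993PadicNumbers, §4.6 Prop. 4.6.1] -/
theorem resGal_padic_mem_rootsOfUnityFixer {ℓ : ℕ} [Fact ℓ.Prime] {m : ℕ} [NeZero m]
    (hm : m ∣ ℓ - 1) (τ : absoluteGaloisGroup ℚ_[ℓ]) :
    resGal (K := ℚ) ℚ_[ℓ] τ ∈ rootsOfUnityFixer ℚ m := by
  obtain ⟨ζ, hζ⟩ := Literature.NumberTheory.LocalFields.padic_exists_isPrimitiveRoot_of_dvd (p := ℓ) hm
  exact resGal_mem_rootsOfUnityFixer_of_isPrimitiveRoot (K := ℚ) ℚ_[ℓ] hζ τ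

/-- **`res(Γ_{ℚ_ℓ}) ≤ Gal(ℚ̄/ℚ_j)` for the cyclotomic `ℤ₂`-tower when `2^{j+2} ∣ ℓ − 1`**: `ℓ` splits
completely in `ℚ(μ_{2^{j+2}}) ⊇ ℚ_j` (tree `IsCyclotomic.rootsOfUnityFixer_le_layerSubgroup_two`).
[cite: Washington1997, §13.1] -/
theorem resGal_padic_mem_layerSubgroup_two {κ : ZpExtension ℚ 2} (hκ : κ.IsCyclotomic) (j : ℕ)
    {ℓ : ℕ} [Fact ℓ.Prime] (hℓ : 2 ^ (j + 2) ∣ ℓ - 1) (τ : absoluteGaloisGroup ℚ_[ℓ]) :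
    resGal (K := ℚ) ℚ_[ℓ] τ ∈ κ.layerSubgroup j := by
  haveI : NeZero (2 ^ (j + 2)) := ⟨pow_ne_zero _ two_ne_zero⟩
  exact hκ.rootsOfUnityFixer_le_layerSubgroup_two j (resGal_padic_mem_rootsOfUnityFixer hℓ τ)

end Fixer

/-! ## §2 Galois descent over a perfect field with FINITE rational torsion (e.g. a local field) -/

section Perfect

variable {F : Type u} [Field F] [PerfectField F] (X : WeierstrassCurve F) (p : ℕ) [hp : Fact p.Prime]

/-- **`E[p^∞]^{Γ_F} ↪ E(F)[p^v]`, `v = ord_p #E(F)_tors`, for a perfect field `F` with finite rational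
torsion.** A `Γ_F`-fixed point of `E[p^∞] ⊆ E(F̄)` is the image of an `F`-rational point (Galois descent,
tree `exists_toGeomPoints_eq_of_forall_smul_eq`), torsion of `p`-power order dividing `#E(F)_tors`, hence
killed by `p^v`. (KitD's `natCard_fixedPoints_geomPrimaryTorsion_le_pow` is the number-field case.)
[cite: SilvermanAEC2009, VIII.§1 (Galois descent) and VII.3] -/
theorem exists_injective_fixedPoints_geomPrimaryTorsion_to_nsmul_eq_zero
    [Finite (AddCommGroup.torsion X.toAffine.Point)] :
    ∃ f : MulAction.fixedPoints (absoluteGaloisGroup F) (geomPrimaryTorsion X p) →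
        {P : X.toAffine.Point // p ^ padicValNat p (Nat.card (AddCommGroup.torsion X.toAffine.Point)) • P = 0},
      Function.Injective f := by
  set v := padicValNat p (Nat.card (AddCommGroup.torsion X.toAffine.Point)) with hv
  have hn0 : Nat.card (AddCommGroup.torsion X.toAffine.Point) ≠ 0 := Nat.card_pos.ne'
  -- Galois descent, point by point
  have hdesc : ∀ m : MulAction.fixedPoints (absoluteGaloisGroup F) (geomPrimaryTorsion X p),
      ∃ P : X.toAffine.Point, p ^ v • P = 0 ∧
        toGeomPoints X P = ((m : geomPrimaryTorsion X p) : geomPoints X) := by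
    intro m
    have hfix : ∀ σ : absoluteGaloisGroup F,
        σ • ((m : geomPrimaryTorsion X p) : geomPoints X) = ((m : geomPrimaryTorsion X p) : geomPoints X) :=
      fun σ ↦ by rw [← primaryComponent.coe_smul, MulAction.mem_fixedPoints.mp m.2 σ]
    obtain ⟨P, hP⟩ := exists_toGeomPoints_eq_of_forall_smul_eq X hfix
    obtain ⟨k, hk⟩ := (m : geomPrimaryTorsion X p).2
    have hPk : p ^ k • P = 0 := by
      apply toGeomPoints_injective X
      rw [map_nsmul, hP, map_zero]
      exact hk
    have hfin : IsOfFinAddOrder P := isOfFinAddOrder_iff_nsmul_eq_zero.mpr ⟨p ^ k, pow_pos hp.out.pos _, hPk⟩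
    obtain ⟨i, -, hi⟩ := (Nat.dvd_prime_pow hp.out).mp (addOrderOf_dvd_of_nsmul_eq_zero hPk)
    have hmemT : P ∈ AddCommGroup.torsion X.toAffine.Point := by
      rw [AddCommGroup.mem_torsion]; exact hfin
    have hiT : p ^ i ∣ Nat.card (AddCommGroup.torsion X.toAffine.Point) := by
      rw [← hi, ← AddSubgroup.addOrderOf_mk P hmemT]
      exact addOrderOf_dvd_natCard _
    have hiv : i ≤ v := (padicValNat_dvd_iff_le hn0).mp hiT
    exact ⟨P, addOrderOf_dvd_iff_nsmul_eq_zero.mp (hi ▸ pow_dvd_pow p hiv), hP⟩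
  refine ⟨fun m ↦ ⟨(hdesc m).choose, (hdesc m).choose_spec.1⟩, fun m m' hmm' ↦ ?_⟩
  have h1 := (hdesc m).choose_spec.2
  have h2 := (hdesc m').choose_spec.2
  have heq : (hdesc m).choose = (hdesc m').choose := congrArg Subtype.val hmm'
  rw [heq, h2] at h1
  exact Subtype.ext (Subtype.ext h1.symm)

omit [PerfectField F] in
/-- `E(F)[p^v]` is finite and of order at most `p^v` when `E(F)_tors` is finite (`v = ord_p #E(F)_tors`):
a `p`-group inside the torsion subgroup (Lagrange). [cite: SilvermanAEC2009, VII.3] -/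
theorem natCard_nsmul_eq_zero_le_pow [Finite (AddCommGroup.torsion X.toAffine.Point)] :
    Finite {P : X.toAffine.Point //
        p ^ padicValNat p (Nat.card (AddCommGroup.torsion X.toAffine.Point)) • P = 0} ∧
      Nat.card {P : X.toAffine.Point //
        p ^ padicValNat p (Nat.card (AddCommGroup.torsion X.toAffine.Point)) • P = 0} ≤
        p ^ padicValNat p (Nat.card (AddCommGroup.torsion X.toAffine.Point)) := by
  set v := padicValNat p (Nat.card (AddCommGroup.torsion X.toAffine.Point)) with hv
  have hn0 : Nat.card (AddCommGroup.torsion X.toAffine.Point) ≠ 0 := Nat.card_pos.ne'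
  let H : AddSubgroup X.toAffine.Point := (DistribSMul.toAddMonoidHom X.toAffine.Point (p ^ v)).ker
  have hH : ∀ P, P ∈ H ↔ p ^ v • P = 0 := fun P ↦ by
    simp only [H, AddMonoidHom.mem_ker, DistribSMul.toAddMonoidHom_apply]
  have hHT : H ≤ AddCommGroup.torsion X.toAffine.Point := fun P hP ↦ by
    rw [AddCommGroup.mem_torsion]
    exact isOfFinAddOrder_iff_nsmul_eq_zero.mpr ⟨p ^ v, pow_pos hp.out.pos _, (hH P).mp hP⟩
  haveI hfinH : Finite H := Finite.of_injective _ (AddSubgroup.inclusion_injective hHT)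
  have hpg : IsPGroup p (Multiplicative H) := fun g ↦ ⟨v, by
    apply Multiplicative.toAdd.injective
    rw [toAdd_pow, toAdd_one]
    exact Subtype.ext (by
      rw [AddSubgroup.coe_nsmul, AddSubgroup.coe_zero]; exact (hH _).mp (Multiplicative.toAdd g).2)⟩
  obtain ⟨j, hj⟩ := IsPGroup.iff_card.mp hpg
  have hjH : Nat.card H = p ^ j := by
    rw [← hj]; exact Nat.card_congr Multiplicative.ofAdd
  have hdvd : p ^ j ∣ Nat.card (AddCommGroup.torsion X.toAffine.Point) := by
    rw [← hjH]; exact AddSubgroup.card_dvd_of_le hHT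
  have hjv : j ≤ v := (padicValNat_dvd_iff_le hn0).mp hdvd
  -- the subtype IS `H`
  have e : {P : X.toAffine.Point // p ^ v • P = 0} ≃ H :=
    { toFun := fun P ↦ ⟨P.1, (hH _).mpr P.2⟩
      invFun := fun P ↦ ⟨P.1, (hH _).mp P.2⟩
      left_inv := fun _ ↦ rfl
      right_inv := fun _ ↦ rfl }
  refine ⟨Finite.of_equiv _ e.symm, ?_⟩
  rw [Nat.card_congr e, hjH]
  exact Nat.pow_le_pow_right hp.out.pos hjv

/-- **`#E[p^∞]^{Γ_F} ≤ p^{ord_p #E(F)_tors}`** for a perfect field `F` with finite rational torsion, and the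
fixed points are finite. [cite: SilvermanAEC2009, VIII.§1 and VII.3] -/
theorem finite_and_natCard_fixedPoints_geomPrimaryTorsion_le_pow
    [Finite (AddCommGroup.torsion X.toAffine.Point)] :
    Finite (MulAction.fixedPoints (absoluteGaloisGroup F) (geomPrimaryTorsion X p)) ∧
      Nat.card (MulAction.fixedPoints (absoluteGaloisGroup F) (geomPrimaryTorsion X p)) ≤
        p ^ padicValNat p (Nat.card (AddCommGroup.torsion X.toAffine.Point)) := by
  obtain ⟨f, hf⟩ := exists_injective_fixedPoints_geomPrimaryTorsion_to_nsmul_eq_zero X p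
  obtain ⟨hfin, hle⟩ := natCard_nsmul_eq_zero_le_pow X p
  haveI := hfin
  exact ⟨Finite.of_injective f hf, (Nat.card_le_card_of_injective f hf).trans hle⟩

end Perfect

/-! ## §3 Fixed points of a subgroup containing a decomposition group inject into LOCAL fixed points -/

section Local

variable {K : Type u} [Field K] (W : WeierstrassCurve K) (E : Type u) [Field E] [Algebra K E]
  (p : ℕ)

/-- **`E[p^∞]^H ↪ E_E[p^∞]^{Γ_E}` when `res(Γ_E) ≤ H`.** For a `K`-field `E` (a completion) and a subgroup
`H ≤ Γ_K` containing the restriction of `Γ_E` (tree `resGal`), the map on points `E(K̄) → E(Ē)` of the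
chosen embedding (tree `pointsMap`, injective and `resGal`-equivariant) carries an `H`-fixed `p`-power
torsion point to a `Γ_E`-fixed `p`-power torsion point of the local curve `W_E = W.baseChange E` (whose
geometric points ARE the tree's local points, same type). [cite: SilvermanAEC2009, VIII.§1 and X.§4]
[cite: SerreGaloisCohomology1997, II.§1.1] -/
theorem natCard_fixedBy_le_natCard_fixedPoints_baseChange (H : Subgroup (absoluteGaloisGroup K))
    (hH : ∀ τ : absoluteGaloisGroup E, resGal (K := K) E τ ∈ H)
    [Finite (MulAction.fixedPoints (absoluteGaloisGroup E) (geomPrimaryTorsion (W.baseChange E) p))] :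
    Nat.card {m : geomPrimaryTorsion W p // ∀ σ ∈ H, σ • m = m} ≤
      Nat.card (MulAction.fixedPoints (absoluteGaloisGroup E) (geomPrimaryTorsion (W.baseChange E) p)) := by
  -- the identity `E(Ē) = E_E(Ē)` (same type) and its compatibility with the two `Γ_E`-actions
  let e : localPoints W E →+ geomPoints (W.baseChange E) :=
    { toFun := fun P ↦ P, map_zero' := rfl, map_add' := fun _ _ ↦ rfl }
  have he : Function.Injective e := fun _ _ h ↦ h
  have hsmul : ∀ (τ : absoluteGaloisGroup E) (P : localPoints W E), e (τ • P) = τ • e P := by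
    intro τ P
    rcases P with _ | ⟨x, y, h⟩
    · rfl
    · rfl
  -- the composite `E(K̄) → E_E(Ē)`
  let g : geomPoints W →+ geomPoints (W.baseChange E) := e.comp (pointsMap W E)
  have hg : Function.Injective g := he.comp (pointsMapOfEmb_injective W _)
  have hgsmul : ∀ (τ : absoluteGaloisGroup E) (P : geomPoints W), g (resGal (K := K) E τ • P) = τ • g P := by
    intro τ P
    change e (pointsMap W E (resGal (K := K) E τ • P)) = τ • e (pointsMap W E P)
    rw [pointsMap_smul, hsmul]
  -- the map on fixed `p`-power torsion points
  have hmem : ∀ m : {m : geomPrimaryTorsion W p // ∀ σ ∈ H, σ • m = m},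
      g ((m : geomPrimaryTorsion W p) : geomPoints W) ∈ geomPrimaryTorsion (W.baseChange E) p := by
    intro m
    obtain ⟨k, hk⟩ := (m : geomPrimaryTorsion W p).2
    exact ⟨k, by rw [← map_nsmul, hk, map_zero]⟩
  have hfix : ∀ m : {m : geomPrimaryTorsion W p // ∀ σ ∈ H, σ • m = m},
      (⟨g ((m : geomPrimaryTorsion W p) : geomPoints W), hmem m⟩ : geomPrimaryTorsion (W.baseChange E) p) ∈
        MulAction.fixedPoints (absoluteGaloisGroup E) (geomPrimaryTorsion (W.baseChange E) p) := by
    intro m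
    rw [MulAction.mem_fixedPoints]
    intro τ
    apply Subtype.ext
    rw [primaryComponent.coe_smul]
    change τ • g ((m : geomPrimaryTorsion W p) : geomPoints W) = g ((m : geomPrimaryTorsion W p) : geomPoints W)
    rw [← hgsmul, ← primaryComponent.coe_smul, m.2 _ (hH τ)]
  refine Nat.card_le_card_of_injective (fun m ↦ ⟨_, hfix m⟩) fun m m' hmm' ↦ ?_
  have h := congrArg (fun x : MulAction.fixedPoints (absoluteGaloisGroup E)
      (geomPrimaryTorsion (W.baseChange E) p) ↦ ((x : geomPrimaryTorsion (W.baseChange E) p) :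
        geomPoints (W.baseChange E))) hmm'
  exact Subtype.ext (Subtype.ext (hg h))

end Local

/-! ## §4 `K = ℚ`, `p = 2`, `E = ℚ_ℓ`: the layer-`j` torsion certificate from a point count -/

section Rat

variable (W : WeierstrassCurve ℚ) [W.IsElliptic] [W.IsGloballyMinimal]

/-- **`#E(ℚ_ℓ)_tors ∣ #Ẽ(𝔽_ℓ)` at a good prime `ℓ ≥ 3`** (so `E(ℚ_ℓ)_tors` is finite): the tree's
`LocalLog.card_torsion_baseChange_dvd` (`#E(ℚ_ℓ)_tors ∣ c_ℓ · #Ẽ_ns(𝔽_ℓ)`, the kernel of reduction is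
torsion-free) with `c_ℓ = 1` at good reduction. [cite: SilvermanAEC2009, VII.3 Prop. 3.1(b) and VII.2.1] -/
theorem card_torsion_baseChange_padic_dvd_reductionPointCount (ℓ : ℕ) [Fact ℓ.Prime] (h3 : 3 ≤ ℓ)
    (hgood : W.HasGoodReductionAtPrime ℓ) :
    Nat.card (AddCommGroup.torsion (W.baseChange ℚ_[ℓ]).toAffine.Point) ∣ W.reductionPointCount ℓ := by
  have hd := Summit.BirchSwinnertonDyer.Rank1Residual.Additive.LocalLog.card_torsion_baseChange_dvd W ℓ h3
  have hc : (W.baseChange ℚ_[ℓ]).localTamagawaNumber ℤ_[ℓ] = 1 := by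
    haveI : ((W.baseChange ℚ_[ℓ]).minimal ℤ_[ℓ]).HasGoodReduction ℤ_[ℓ] := hgood
    exact localTamagawaNumber_eq_one_of_hasGoodReduction_holds ℤ_[ℓ] (W.baseChange ℚ_[ℓ])
  rwa [hc, one_mul] at hd

/-- `E(ℚ_ℓ)_tors` is finite at a good prime `ℓ ≥ 3` (its order divides `#Ẽ(𝔽_ℓ) > 0`).
[cite: SilvermanAEC2009, VII.3 Prop. 3.1(b)] -/
theorem finite_torsion_baseChange_padic (ℓ : ℕ) [Fact ℓ.Prime] (h3 : 3 ≤ ℓ)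
    (hgood : W.HasGoodReductionAtPrime ℓ) :
    Finite (AddCommGroup.torsion (W.baseChange ℚ_[ℓ]).toAffine.Point) := by
  apply Nat.finite_of_card_ne_zero
  intro h0
  have hd := card_torsion_baseChange_padic_dvd_reductionPointCount W ℓ h3 hgood
  rw [h0, zero_dvd_iff] at hd
  exact (W.reductionPointCount_pos ℓ).ne' hd

/-- **THE LAYER-`j` TORSION CERTIFICATE.** For the cyclotomic `ℤ₂`-extension of `ℚ` (any cyclotomic `κ`),
a layer `j` and a good prime `ℓ ≥ 3` with `2^{j+2} ∣ ℓ − 1`: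
`#E[2^∞]^{Gal(ℚ̄/ℚ_j)} ≤ 2^{ord₂ #Ẽ(𝔽_ℓ)}`. Chain: `Gal(ℚ̄/ℚ_j) ≥ Gal(ℚ̄/ℚ(μ_{2^{j+2}})) ≥ res(Γ_{ℚ_ℓ})`
(§1), so a layer-`j`-fixed `2`-power torsion point of `E(ℚ̄)` gives a `Γ_{ℚ_ℓ}`-fixed one of `E(ℚ̄_ℓ)`
(§3), i.e. a point of `E(ℚ_ℓ)[2^∞]` (§2, Galois descent over `ℚ_ℓ`), and `#E(ℚ_ℓ)_tors ∣ #Ẽ(𝔽_ℓ)`.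
At `j = 0` (`4 ∣ ℓ − 1` or any good odd `ℓ`) this is KitD's `natCard_fixedPoints_geomPrimaryTorsion_le_pow_of_good`.
[cite: SilvermanAEC2009, VII.3 Prop. 3.1(b), VIII.§1] [cite: Washington1997, §13.1]
[cite: Gouvea1993PadicNumbers, §4.6 Prop. 4.6.1] -/
theorem natCard_fixedBy_layerSubgroup_le_pow_of_goodPrime {κ : ZpExtension ℚ 2} (hκ : κ.IsCyclotomic)
    (j ℓ : ℕ) [Fact ℓ.Prime] (h3 : 3 ≤ ℓ) (hgood : W.HasGoodReductionAtPrime ℓ)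
    (hℓ1 : 2 ^ (j + 2) ∣ ℓ - 1) {t : ℕ} (hℓ : padicValNat 2 (W.reductionPointCount ℓ) ≤ t) :
    Nat.card {m : geomPrimaryTorsion W 2 | ∀ σ ∈ κ.layerSubgroup j, σ • m = m} ≤ 2 ^ t := by
  haveI := finite_torsion_baseChange_padic W ℓ h3 hgood
  obtain ⟨hfin, hle⟩ := finite_and_natCard_fixedPoints_geomPrimaryTorsion_le_pow (W.baseChange ℚ_[ℓ]) 2
  haveI := hfin
  have hN0 : W.reductionPointCount ℓ ≠ 0 := (W.reductionPointCount_pos ℓ).ne'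
  have hv : padicValNat 2 (Nat.card (AddCommGroup.torsion (W.baseChange ℚ_[ℓ]).toAffine.Point)) ≤
      padicValNat 2 (W.reductionPointCount ℓ) :=
    (padicValNat_dvd_iff_le hN0).mp
      (pow_padicValNat_dvd.trans (card_torsion_baseChange_padic_dvd_reductionPointCount W ℓ h3 hgood))
  calc Nat.card {m : geomPrimaryTorsion W 2 | ∀ σ ∈ κ.layerSubgroup j, σ • m = m}
      ≤ Nat.card (MulAction.fixedPoints (absoluteGaloisGroup ℚ_[ℓ])
          (geomPrimaryTorsion (W.baseChange ℚ_[ℓ]) 2)) :=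
        natCard_fixedBy_le_natCard_fixedPoints_baseChange W ℚ_[ℓ] 2 (κ.layerSubgroup j)
          (resGal_padic_mem_layerSubgroup_two hκ j hℓ1)
    _ ≤ 2 ^ padicValNat 2 (Nat.card (AddCommGroup.torsion (W.baseChange ℚ_[ℓ]).toAffine.Point)) := hle
    _ ≤ 2 ^ t := Nat.pow_le_pow_right two_pos (hv.trans hℓ)

/-- The same certificate from a DECIDABLE point count: `#Ẽ(𝔽_ℓ) = n`, `¬ 2^{t+1} ∣ n`.
[cite: SilvermanAEC2009, VII.3 Prop. 3.1(b)] -/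
theorem natCard_fixedBy_layerSubgroup_le_pow_of_goodPrime_card {κ : ZpExtension ℚ 2} (hκ : κ.IsCyclotomic)
    (j ℓ : ℕ) [Fact ℓ.Prime] (h3 : 3 ≤ ℓ) (hgood : W.HasGoodReductionAtPrime ℓ)
    (hℓ1 : 2 ^ (j + 2) ∣ ℓ - 1) {t n : ℕ} (hn : W.reductionPointCount ℓ = n) (hndvd : ¬ 2 ^ (t + 1) ∣ n) :
    Nat.card {m : geomPrimaryTorsion W 2 | ∀ σ ∈ κ.layerSubgroup j, σ • m = m} ≤ 2 ^ t := by
  have hn0 : n ≠ 0 := hn ▸ (W.reductionPointCount_pos ℓ).ne'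
  exact natCard_fixedBy_layerSubgroup_le_pow_of_goodPrime W hκ j ℓ h3 hgood hℓ1
    (hn ▸ TowerClass.padicValNat_le_of_not_pow_succ_dvd hn0 hndvd)

end Rat

end Summit.BirchSwinnertonDyer.BirchSwinnertonDyer.Theorems.TowerLayer

/-! ## §5 The torsion-tolerant TOWER-gap doors at a layer pair `(j, j')`, `j ≥ 1`, in certificate currency -/

namespace Summit.BirchSwinnertonDyer.BirchSwinnertonDyer.Theorems.TowerClass

open Summit.BirchSwinnertonDyer.Rank1Residual.X5.O1 Summit.BirchSwinnertonDyer.BirchSwinnertonDyer.Theorems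

variable (W : WeierstrassCurve ℚ) [W.IsElliptic] [W.IsGloballyMinimal]

/-- **Gap from `(j, j')` counts with rational `2`-torsion, STRICT (Selmer) lower count at layer `j`**:
PRINT `hB` (finiteness of `E(ℚ_∞)[2^∞]`) + CERT {`2^a ≤ #Sel_{2^∞}(E/ℚ_j)[2]`, `#A_{j'}[2] ≤ 2^d`, a good
prime `ℓ ≥ 3` with `2^{j+2} ∣ ℓ − 1`, `#Ẽ(𝔽_ℓ) = n`, `¬ 2^{t+1} ∣ n`, `d + t + 1 ≤ 2^{j'} − 2^j + a`}
⇒ `O1.TowerGapAtTwo W` (TowerLayerTorsion §2 with the layer-`j` torsion count certified by §4).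
[cite: GreenbergLNM1716, §1 p. 60 and p. 62, §3 pp. 85–86, §4 Lemma 4.3] [cite: SilvermanAEC2009, VII.3 Prop. 3.1(b)] -/
theorem towerGapAtTwo_of_counts_of_goodPrime_card_layer
    (hB : Greenberg1999.finite_torsion_cyclotomicZpExtension) {j j' a d t n : ℕ} (hjj' : j ≤ j')
    (ℓ : ℕ) [Fact ℓ.Prime] (h3 : 3 ≤ ℓ) (hgood : W.HasGoodReductionAtPrime ℓ) (hℓ1 : 2 ^ (j + 2) ∣ ℓ - 1)
    (hn : W.reductionPointCount ℓ = n) (hndvd : ¬ 2 ^ (t + 1) ∣ n)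
    (hlow : ∀ κ : ZpExtension ℚ 2, κ.IsCyclotomic →
      2 ^ a ≤ Nat.card {z : W.selmerLayer κ j // 2 • z = 0})
    (hup : ∀ κ : ZpExtension ℚ 2, κ.IsCyclotomic →
      Nat.card {z : W.selmerInftyPreimage κ j' // 2 • z = 0} ≤ 2 ^ d)
    (had : d + t + 1 ≤ 2 ^ j' - 2 ^ j + a) : TowerGapAtTwo W :=
  towerGapAtTwo_of_counts_of_torsion_print W hB hjj' hlow
    (fun _ hκ ↦ TowerLayer.natCard_fixedBy_layerSubgroup_le_pow_of_goodPrime_card W hκ j ℓ h3 hgood hℓ1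
      hn hndvd) hup had

/-- **Gap from `(j, j')` counts with rational `2`-torsion, `A`-currency lower count at layer `j`**
(`2^a ≤ #A_j[2]`, KitE's door) with the layer-`j` torsion count certified by §4.
[cite: GreenbergLNM1716, §1 p. 60 and p. 62, §3 pp. 85–86, §4 Lemma 4.3] [cite: SilvermanAEC2009, VII.3 Prop. 3.1(b)] -/
theorem towerGapAtTwo_of_classCounts_of_goodPrime_card_layer
    (hB : Greenberg1999.finite_torsion_cyclotomicZpExtension) {j j' a d t n : ℕ} (hjj' : j ≤ j')
    (ℓ : ℕ) [Fact ℓ.Prime] (h3 : 3 ≤ ℓ) (hgood : W.HasGoodReductionAtPrime ℓ) (hℓ1 : 2 ^ (j + 2) ∣ ℓ - 1)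
    (hn : W.reductionPointCount ℓ = n) (hndvd : ¬ 2 ^ (t + 1) ∣ n)
    (hlow : ∀ κ : ZpExtension ℚ 2, κ.IsCyclotomic →
      2 ^ a ≤ Nat.card {z : W.selmerInftyPreimage κ j // 2 • z = 0})
    (hup : ∀ κ : ZpExtension ℚ 2, κ.IsCyclotomic →
      Nat.card {z : W.selmerInftyPreimage κ j' // 2 • z = 0} ≤ 2 ^ d)
    (had : d + t + 1 ≤ 2 ^ j' - 2 ^ j + a) : TowerGapAtTwo W :=
  towerGapAtTwo_of_classCounts_of_torsion W (fun κ hκ ↦ hB W 2 κ hκ) hjj' hlow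
    (fun _ hκ ↦ TowerLayer.natCard_fixedBy_layerSubgroup_le_pow_of_goodPrime_card W hκ j ℓ h3 hgood hℓ1
      hn hndvd) hup had

end Summit.BirchSwinnertonDyer.BirchSwinnertonDyer.Theorems.TowerClass

end
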